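import Summits.CriticalPhenomena.PercolationContinuityZ3.Theorems.PercNearOneGluingNoHeavyPcintBSMRFourier
import Summits.CriticalPhenomena.PercolationContinuityZ3.Theorems.PercNearOneGluingNoHeavyPcintBSMXFourierTail
import HarnessLib

/-!
# PCINT lane, PHASE 9 (block renewal with reach-`m` pieces), step 4: uniform (Fourier) bounds for the Green tails

Cell `prim-pcint`, seat `prim-pcint-1` (gen 17); memo `run/shared/lean/prim/pcint/T-FIBRE-ROUTE.md` §PHASE 9.

The terms of the Green series of the pair offset chain are `u k i · Π_l H m g (2i) (δ l)` (…PcintBSMRGreen), with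
`t ≥ 2` transverse coordinates.  This file packages tail bounds exactly as …PcintBSMXTail / …PcintBSMXFourierTail
(the case `m = 2`), now for a general symmetric law: the finite sums `BSMR.G0H`, `BSMR.G1H`, the tail predicate
**`BSMR.TailBoundH`**, the Fourier data `BSMR.FData` (the hypotheses of `BSMR.H_le_fourier`), the termwise bound
`Π_l H (2i) (δ l) ≤ bF i` (**`BSMR.prod_H_le_bF`**, reusing `BSMX.HB`, `BSMX.bF`, `BSMX.HB_sq_le`), the two tails
**`BSMR.tailBound_two_fourier`** (`k = 2`, exact telescoping of `u 2`) and **`BSMR.tailBound_three_fourier`**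
(`k ≥ 3`, `u k i (i+1) ≤ Cu`), and their discharges from RATIONAL data: the law from naturals `BSMR.lawN A DA`
(`BSMR.LawNatOK`, decidable), the side conditions `BSMR.FourierCheckQ` (decidable), and
**`BSMR.tailBoundH_of_twoFourierQ`** / **`BSMR.tailBoundH_of_threeFourierQ`**.
-/

noncomputable section

namespace Summit.CriticalPhenomena.PercolationContinuityZ3.Theorems.Pcint.BSMR

open Finset OSM BSM Real

variable {m t k : ℕ}

/-! ### The finite Green sums and the tail package -/

/-- The finite diagonal Green sum `Σ_{i<N} u k i · Π_l H m g (2i) (δ l)`. -/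
def G0H (k m : ℕ) (g : Fin (2 * m + 1) → ℝ) (N : ℕ) (δ : Fin t → ℤ) : ℝ :=
  ∑ i ∈ range N, u k i * ∏ l, H m g (2 * i) (δ l)

/-- The finite adjacent Green sum `Σ_{i<N} c_i · Π_l H m g (2i) (δ l)`. -/
def G1H (k m : ℕ) (g : Fin (2 * m + 1) → ℝ) (N : ℕ) (δ : Fin t → ℤ) : ℝ :=
  ∑ i ∈ range N, cadj k i * ∏ l, H m g (2 * i) (δ l)

/-- **A tail bound `T` for the Green sums at horizon `N`**: nonnegative, and the partial sums of both the diagonal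
and the adjacent Green series are below the finite sums to horizon `N` plus `T`, uniformly in the length `n`. -/
def TailBoundH (t k m : ℕ) (g : Fin (2 * m + 1) → ℝ) (N : ℕ) (T : ℝ) : Prop :=
  0 ≤ T ∧ ∀ (n : ℕ) (δ : Fin t → ℤ),
    (∑ i ∈ range n, u k i * ∏ l, H m g (2 * i) (δ l) ≤ G0H k m g N δ + T) ∧
      (∑ i ∈ range n, cadj k i * ∏ l, H m g (2 * i) (δ l) ≤ G1H k m g N δ + T)

/-- **From a window bound on `u k i · b i` (any termwise bound `b`) to a tail bound.** -/
theorem tailBoundH_of_window' {g : Fin (2 * m + 1) → ℝ} (hg : LawOK m g) (hk : 2 ≤ k) {b : ℕ → ℝ}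
    (hb : ∀ (i : ℕ) (δ : Fin t → ℤ), ∏ l, H m g (2 * i) (δ l) ≤ b i) {N : ℕ} {T : ℝ} (hT : 0 ≤ T)
    (hwin : ∀ n, ∑ i ∈ Ico N n, u k i * b i ≤ T) : TailBoundH t k m g N T := by
  have hterm : ∀ (i : ℕ) (δ : Fin t → ℤ), u k i * ∏ l, H m g (2 * i) (δ l) ≤ u k i * b i :=
    fun i δ => mul_le_mul_of_nonneg_left (hb i δ) (u_nonneg i)
  refine ⟨hT, fun n δ => ⟨?_, ?_⟩⟩
  · exact BSMX.sum_le_range_add hT (fun i => mul_nonneg (u_nonneg i) (prod_H_nonneg hg _ δ))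
      (fun n => (sum_le_sum fun i _ => hterm i δ).trans (hwin n)) n
  · exact BSMX.sum_le_range_add hT (fun i => mul_nonneg (cadj_bounds hk i).1 (prod_H_nonneg hg _ δ))
      (fun n => (sum_le_sum fun i _ => (mul_le_mul_of_nonneg_right (cadj_bounds hk i).2 (prod_H_nonneg hg _ δ)).trans
        (hterm i δ)).trans (hwin n)) n

/-! ### The Fourier data -/

/-- **Fourier data**: the hypotheses of `BSMR.H_le_fourier` (with `m₀ > 0`): admissible concentrated law
(`2 g(0) ≥ 1`), reach `m ≥ 1`, `0 < θ₀`, `m θ₀ ≤ 1`, `0 < c ≤ s₂/2 - (5/96) θ₀² s₄`, `0 < m₀ ≤ (g(-1)+g(1)) L(θ₀)`. -/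
def FData (m : ℕ) (g : Fin (2 * m + 1) → ℝ) (θ₀ c m₀ : ℝ) : Prop :=
  LawOK m g ∧ 1 ≤ m ∧ 1 ≤ 2 * g (ctr m) ∧ 0 < θ₀ ∧ (m : ℝ) * θ₀ ≤ 1 ∧ 0 < c ∧
    c ≤ s₂ m g / 2 - 5 / 96 * θ₀ ^ 2 * s₄ m g ∧ 0 < m₀ ∧ m₀ ≤ (g (oneN m) + g (oneP m)) * BSMX.Lcos θ₀

namespace FData

variable {g : Fin (2 * m + 1) → ℝ} {θ₀ c m₀ : ℝ}

/-- admissible law -/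
theorem law (h : FData m g θ₀ c m₀) : LawOK m g := h.1
/-- `m ≥ 1` -/
theorem one_le (h : FData m g θ₀ c m₀) : 1 ≤ m := h.2.1
/-- concentration -/
theorem ctr (h : FData m g θ₀ c m₀) : 1 ≤ 2 * g (BSMR.ctr m) := h.2.2.1
/-- `θ₀ > 0` -/
theorem θ₀_pos (h : FData m g θ₀ c m₀) : 0 < θ₀ := h.2.2.2.1
/-- `m θ₀ ≤ 1` -/
theorem mθ₀ (h : FData m g θ₀ c m₀) : (m : ℝ) * θ₀ ≤ 1 := h.2.2.2.2.1
/-- `c > 0` -/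
theorem c_pos (h : FData m g θ₀ c m₀) : 0 < c := h.2.2.2.2.2.1
/-- the quadratic constant -/
theorem c_le (h : FData m g θ₀ c m₀) : c ≤ s₂ m g / 2 - 5 / 96 * θ₀ ^ 2 * s₄ m g := h.2.2.2.2.2.2.1
/-- `m₀ > 0` -/
theorem m₀_pos (h : FData m g θ₀ c m₀) : 0 < m₀ := h.2.2.2.2.2.2.2.1
/-- the gap -/
theorem m₀_le (h : FData m g θ₀ c m₀) : m₀ ≤ (g (oneN m) + g (oneP m)) * BSMX.Lcos θ₀ := h.2.2.2.2.2.2.2.2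

end FData

/-- `H (2i) δ ≤ HB i` for `i ≥ 1`. -/
theorem H_two_mul_le_HB {g : Fin (2 * m + 1) → ℝ} {θ₀ c m₀ : ℝ} (h : FData m g θ₀ c m₀) {i : ℕ} (hi : 1 ≤ i)
    (δ : ℤ) : H m g (2 * i) δ ≤ BSMX.HB c m₀ i := by
  have := H_le_fourier h.law h.one_le h.ctr h.θ₀_pos h.mθ₀ h.c_pos h.c_le h.m₀_le (n := 2 * i) (by omega) δ
  unfold BSMX.HB
  push_cast at this
  exact this

/-- **The transverse factor bound**: `Π_l H (2i) (δ l) ≤ bF i` (`t ≥ 2`). -/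
theorem prod_H_le_bF {g : Fin (2 * m + 1) → ℝ} {θ₀ c m₀ κ : ℝ} (h : FData m g θ₀ c m₀) (hκ : 0 ≤ κ)
    (hκ2 : 1 ≤ κ ^ 2 * (2 * π * c)) (ht : 2 ≤ t) (i : ℕ) (δ : Fin t → ℤ) :
    ∏ l, H m g (2 * i) (δ l) ≤ BSMX.bF c m₀ κ i := by
  unfold BSMX.bF
  split_ifs with hi
  · exact prod_H_le_one h.law _ δ
  · have hi1 : 1 ≤ i := Nat.one_le_iff_ne_zero.2 hi
    refine (prod_H_le_two h.law ht (2 * i) δ).trans ?_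
    have h0 := fun l => H_nonneg h.law (2 * i) (δ l)
    have e0 := H_two_mul_le_HB h hi1 (δ ⟨0, by omega⟩)
    have e1 := H_two_mul_le_HB h hi1 (δ ⟨1, by omega⟩)
    calc H m g (2 * i) (δ ⟨0, by omega⟩) * H m g (2 * i) (δ ⟨1, by omega⟩) ≤ BSMX.HB c m₀ i * BSMX.HB c m₀ i :=
          mul_le_mul e0 e1 (h0 _) (BSMX.HB_nonneg c m₀ i)
      _ = BSMX.HB c m₀ i ^ 2 := (sq _).symm
      _ ≤ _ := BSMX.HB_sq_le h.c_pos h.m₀_pos.le hκ hκ2 hi1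

/-! ### Two time axes -/

/-- **The Fourier tail for two time axes**: any
`T ≥ u 2 N · [(2N+2)/(8π c N) + (κ+1) r^{2N}/(1-r²)]`, `r = e^{-m₀}`, is a tail bound (`t ≥ 2`, `N ≥ 1`). -/
theorem tailBound_two_fourier {g : Fin (2 * m + 1) → ℝ} {θ₀ c m₀ κ : ℝ} (h : FData m g θ₀ c m₀) (hκ : 0 ≤ κ)
    (hκ2 : 1 ≤ κ ^ 2 * (2 * π * c)) (ht : 2 ≤ t) {N : ℕ} (hN : 1 ≤ N) {T : ℝ}
    (hT : u 2 N * ((2 * (N : ℝ) + 2) / (8 * π * c * N) +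
      (κ + 1) * Real.exp (-m₀) ^ (2 * N) / (1 - Real.exp (-m₀) ^ 2)) ≤ T) :
    TailBoundH t 2 m g N T := by
  have hπ := Real.pi_pos; have hc := h.c_pos
  set r := Real.exp (-m₀) with hr
  have hr0 : 0 ≤ r := (Real.exp_pos _).le
  have hr1 : r < 1 := Real.exp_lt_one_iff.2 (by linarith [h.m₀_pos])
  have hr2 : 0 < 1 - r ^ 2 := by nlinarith
  have huN := u_nonneg (d := 2) N
  have hT0 : 0 ≤ u 2 N * ((2 * (N : ℝ) + 2) / (8 * π * c * N) + (κ + 1) * r ^ (2 * N) / (1 - r ^ 2)) := by positivity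
  refine tailBoundH_of_window' h.law le_rfl (fun i δ => prod_H_le_bF h hκ hκ2 ht i δ) (hT0.trans hT)
    fun M => le_trans ?_ hT
  have hsplit : ∑ i ∈ Ico N M, u 2 i * BSMX.bF c m₀ κ i =
      (1 / (8 * π * c)) * ∑ i ∈ Ico N M, u 2 i / (i : ℝ) + (κ + 1) * ∑ i ∈ Ico N M, u 2 i * r ^ (2 * i) := by
    rw [mul_sum, mul_sum, ← sum_add_distrib]
    refine sum_congr rfl fun i hi => ?_
    have hi1 : i ≠ 0 := by have := (mem_Ico.1 hi).1; omega
    have hi0 : (0 : ℝ) < i := by exact_mod_cast Nat.pos_of_ne_zero hi1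
    rw [BSMX.bF, if_neg hi1, hr]
    field_simp
  rw [hsplit]
  have h1 := BSMX.window_two_inv hN M
  have h2 := BSMX.window_geo hr0 hr1 N M
  have hNR : (0 : ℝ) < N := by exact_mod_cast hN
  calc 1 / (8 * π * c) * ∑ i ∈ Ico N M, u 2 i / (i : ℝ) + (κ + 1) * ∑ i ∈ Ico N M, u 2 i * r ^ (2 * i)
      ≤ 1 / (8 * π * c) * (u 2 N * (2 * (N : ℝ) + 2) / N) + (κ + 1) * (u 2 N * r ^ (2 * N) / (1 - r ^ 2)) :=
        add_le_add (mul_le_mul_of_nonneg_left h1 (by positivity)) (mul_le_mul_of_nonneg_left h2 (by positivity))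
    _ = u 2 N * ((2 * (N : ℝ) + 2) / (8 * π * c * N) + (κ + 1) * r ^ (2 * N) / (1 - r ^ 2)) := by
        field_simp

/-! ### Three or more time axes -/

/-- **The Fourier tail for `k ≥ 3` time axes**: any
`T ≥ Cu k q₀ · [1/(8π c N) + (κ+1) r^{2N}/((N+1)(1-r²))]`, `r = e^{-m₀}`, is a tail bound
(`N ≥ q₀ k`, `N ≥ 1`, `t ≥ 2`). -/
theorem tailBound_three_fourier {g : Fin (2 * m + 1) → ℝ} {θ₀ c m₀ κ : ℝ} (h : FData m g θ₀ c m₀) (hκ : 0 ≤ κ)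
    (hκ2 : 1 ≤ κ ^ 2 * (2 * π * c)) (hk : 3 ≤ k) (ht : 2 ≤ t) {q₀ N : ℕ} (hN : q₀ * k ≤ N) (hN1 : 1 ≤ N) {T : ℝ}
    (hT : BSMX.Cu k q₀ * (1 / (8 * π * c * N) +
      (κ + 1) * Real.exp (-m₀) ^ (2 * N) / (((N : ℝ) + 1) * (1 - Real.exp (-m₀) ^ 2))) ≤ T) :
    TailBoundH t k m g N T := by
  have hπ := Real.pi_pos; have hc := h.c_pos
  have hk0 : 0 < k := by omega
  set r := Real.exp (-m₀) with hr
  have hr0 : 0 ≤ r := (Real.exp_pos _).le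
  have hr1 : r < 1 := Real.exp_lt_one_iff.2 (by linarith [h.m₀_pos])
  have hr2 : 0 < 1 - r ^ 2 := by nlinarith
  have hC := BSMX.Cu_nonneg hk0 q₀
  have hT0 : 0 ≤ BSMX.Cu k q₀ * (1 / (8 * π * c * N) + (κ + 1) * r ^ (2 * N) / (((N : ℝ) + 1) * (1 - r ^ 2))) := by
    positivity
  refine tailBoundH_of_window' h.law (by omega) (fun i δ => prod_H_le_bF h hκ hκ2 ht i δ) (hT0.trans hT)
    fun M => le_trans ?_ hT
  have hterm : ∀ i ∈ Ico N M, u k i * BSMX.bF c m₀ κ i ≤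
      BSMX.Cu k q₀ / (8 * π * c) * (1 / (i : ℝ) - 1 / ((i : ℝ) + 1)) +
        (κ + 1) * BSMX.Cu k q₀ * (r ^ (2 * i) / ((i : ℝ) + 1)) := by
    intro i hi
    have hNi := (mem_Ico.1 hi).1
    have hi1 : i ≠ 0 := by omega
    have hi0 : (0 : ℝ) < i := by exact_mod_cast Nat.pos_of_ne_zero hi1
    have hu := BSMX.u_mul_le hk (hN.trans hNi)
    have hu' : u k i ≤ BSMX.Cu k q₀ / ((i : ℝ) + 1) := by
      rw [le_div_iff₀ (by positivity)]; unfold BSMX.Cu; linarith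
    have hii : 1 / (i : ℝ) - 1 / ((i : ℝ) + 1) = 1 / ((i : ℝ) * ((i : ℝ) + 1)) := by field_simp; ring
    rw [BSMX.bF, if_neg hi1, ← hr, hii]
    have hb0 : 0 ≤ 1 / (8 * π * c * (i : ℝ)) + (κ + 1) * r ^ (2 * i) := by positivity
    calc u k i * (1 / (8 * π * c * (i : ℝ)) + (κ + 1) * r ^ (2 * i))
        ≤ BSMX.Cu k q₀ / ((i : ℝ) + 1) * (1 / (8 * π * c * (i : ℝ)) + (κ + 1) * r ^ (2 * i)) :=
          mul_le_mul_of_nonneg_right hu' hb0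
      _ = BSMX.Cu k q₀ / (8 * π * c) * (1 / ((i : ℝ) * ((i : ℝ) + 1))) +
          (κ + 1) * BSMX.Cu k q₀ * (r ^ (2 * i) / ((i : ℝ) + 1)) := by
          field_simp
  have h1 := sum_Ico_telescope_le N M
  have h2 := BSMX.window_geo_div hr0 hr1 N M
  have hNR : (0 : ℝ) < N := by exact_mod_cast hN1
  calc ∑ i ∈ Ico N M, u k i * BSMX.bF c m₀ κ i
      ≤ ∑ i ∈ Ico N M, (BSMX.Cu k q₀ / (8 * π * c) * (1 / (i : ℝ) - 1 / ((i : ℝ) + 1)) +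
          (κ + 1) * BSMX.Cu k q₀ * (r ^ (2 * i) / ((i : ℝ) + 1))) := sum_le_sum hterm
    _ = BSMX.Cu k q₀ / (8 * π * c) * ∑ i ∈ Ico N M, (1 / (i : ℝ) - 1 / ((i : ℝ) + 1)) +
          (κ + 1) * BSMX.Cu k q₀ * ∑ i ∈ Ico N M, r ^ (2 * i) / ((i : ℝ) + 1) := by
        rw [sum_add_distrib, mul_sum, mul_sum]
    _ ≤ BSMX.Cu k q₀ / (8 * π * c) * (1 / (N : ℝ)) +
          (κ + 1) * BSMX.Cu k q₀ * (r ^ (2 * N) / (((N : ℝ) + 1) * (1 - r ^ 2))) :=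
        add_le_add (mul_le_mul_of_nonneg_left h1 (by positivity)) (mul_le_mul_of_nonneg_left h2 (by positivity))
    _ = BSMX.Cu k q₀ * (1 / (8 * π * c * N) + (κ + 1) * r ^ (2 * N) / (((N : ℝ) + 1) * (1 - r ^ 2))) := by
        field_simp

/-! ### The law from naturals -/

/-- The law `A/DA` on the letters from a list of `2m+1` numerators. -/
def lawN (m : ℕ) (A : List ℕ) (DA : ℕ) (c : Fin (2 * m + 1)) : ℝ := ((A.getD c 0 : ℕ) : ℝ) / DA

/-- **Decidable admissibility of the numerators**: positive denominator, total `DA`, symmetric. -/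
def LawNatOK (m : ℕ) (A : List ℕ) (DA : ℕ) : Prop :=
  0 < DA ∧ (∑ c : Fin (2 * m + 1), A.getD c 0) = DA ∧ ∀ c : Fin (2 * m + 1), A.getD (Fin.rev c) 0 = A.getD c 0

/-- The numerators give an admissible law. -/
theorem lawOK_of_nat {A : List ℕ} {DA : ℕ} (h : LawNatOK m A DA) : LawOK m (lawN m A DA) := by
  obtain ⟨hDA, hsum, hsym⟩ := h
  have hDAR : (0 : ℝ) < DA := by exact_mod_cast hDA
  refine ⟨fun c => by unfold lawN; positivity, ?_, fun c => by unfold lawN; rw [hsym]⟩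
  unfold lawN
  rw [← sum_div, div_eq_one_iff_eq hDAR.ne']
  exact_mod_cast hsum

/-- The numerators of the law, letter by letter. -/
theorem lawN_apply (A : List ℕ) (DA : ℕ) (c : Fin (2 * m + 1)) : lawN m A DA c = ((A.getD c 0 : ℕ) : ℝ) / DA := rfl

/-! ### Kernel discharges from rational data -/

/-- The second moment over `ℚ`. -/
def s₂Q (m : ℕ) (A : List ℕ) (DA : ℕ) : ℚ :=
  ∑ c : Fin (2 * m + 1), ((A.getD c 0 : ℕ) : ℚ) / DA * (((c : ℤ) - m : ℤ) : ℚ) ^ 2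

/-- The fourth moment over `ℚ`. -/
def s₄Q (m : ℕ) (A : List ℕ) (DA : ℕ) : ℚ :=
  ∑ c : Fin (2 * m + 1), ((A.getD c 0 : ℕ) : ℚ) / DA * (((c : ℤ) - m : ℤ) : ℚ) ^ 4

/-- The moments cast. -/
theorem s₂Q_cast (A : List ℕ) (DA : ℕ) : ((s₂Q m A DA : ℚ) : ℝ) = s₂ m (lawN m A DA) := by
  unfold s₂Q s₂ lawN val; push_cast; rfl

/-- The moments cast. -/
theorem s₄Q_cast (A : List ℕ) (DA : ℕ) : ((s₄Q m A DA : ℚ) : ℝ) = s₄ m (lawN m A DA) := by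
  unfold s₄Q s₄ lawN val; push_cast; rfl

/-- **The decidable side conditions** of the Fourier data for the law `A/DA` with rational `θ₀, c, m₀` and a
rational `κ` with `κ² (2 piLo c) ≥ 1` (so `κ ≥ 1/√(2π c)`). -/
def FourierCheckQ (m : ℕ) (A : List ℕ) (DA : ℕ) (θ₀ c m₀ κ : ℚ) : Prop :=
  1 ≤ m ∧ DA ≤ 2 * A.getD m 0 ∧ 0 < θ₀ ∧ (m : ℚ) * θ₀ ≤ 1 ∧ 0 < c ∧
    c ≤ s₂Q m A DA / 2 - 5 / 96 * θ₀ ^ 2 * s₄Q m A DA ∧ 0 < m₀ ∧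
      m₀ ≤ (((A.getD (m - 1) 0 : ℕ) : ℚ) / DA + ((A.getD (m + 1) 0 : ℕ) : ℚ) / DA) * BSMX.LcosQ θ₀ ∧
        0 ≤ κ ∧ 1 ≤ κ ^ 2 * (2 * BSMX.piLo * c)

/-- **From the rational checks to the Fourier data** (and the real inequality `κ² (2π c) ≥ 1`). -/
theorem fdata_of_checkQ {A : List ℕ} {DA : ℕ} (hA : LawNatOK m A DA) {θ₀ c m₀ κ : ℚ}
    (hq : FourierCheckQ m A DA θ₀ c m₀ κ) :
    FData m (lawN m A DA) θ₀ c m₀ ∧ 0 ≤ (κ : ℝ) ∧ 1 ≤ (κ : ℝ) ^ 2 * (2 * π * c) := by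
  obtain ⟨hm, hctr, hθ0, hmθ, hc0, hc1, hm0, hm1, hκ0, hκ1⟩ := hq
  have hlaw := lawOK_of_nat hA
  have hDAR : (0 : ℝ) < DA := by exact_mod_cast hA.1
  have ectr : 1 ≤ 2 * lawN m A DA (ctr m) := by
    unfold lawN ctr
    have : (DA : ℝ) ≤ 2 * (A.getD m 0 : ℕ) := by exact_mod_cast hctr
    rw [show (2 : ℝ) * (((A.getD m 0 : ℕ) : ℝ) / DA) = (2 * (A.getD m 0 : ℕ)) / DA by ring, le_div_iff₀ hDAR]
    simpa using this
  have eθ0 : (0 : ℝ) < θ₀ := by exact_mod_cast hθ0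
  have emθ : (m : ℝ) * θ₀ ≤ 1 := by have := (Rat.cast_le (K := ℝ)).2 hmθ; push_cast at this; exact this
  have ec0 : (0 : ℝ) < c := by exact_mod_cast hc0
  have ec1 : (c : ℝ) ≤ s₂ m (lawN m A DA) / 2 - 5 / 96 * (θ₀ : ℝ) ^ 2 * s₄ m (lawN m A DA) := by
    have := (Rat.cast_le (K := ℝ)).2 hc1; push_cast at this; rw [s₂Q_cast, s₄Q_cast] at this; exact this
  have em0 : (0 : ℝ) < m₀ := by exact_mod_cast hm0
  have em1 : (m₀ : ℝ) ≤ (lawN m A DA (oneN m) + lawN m A DA (oneP m)) * BSMX.Lcos θ₀ := by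
    have := (Rat.cast_le (K := ℝ)).2 hm1; push_cast at this; rw [BSMX.LcosQ_cast] at this
    have e1 : ((oneN m : Fin (2 * m + 1)) : ℕ) = m - 1 := rfl
    have e2 : ((oneP m : Fin (2 * m + 1)) : ℕ) = m + 1 := by show min (m + 1) (2 * m) = m + 1; omega
    unfold lawN; rw [e1, e2]; exact this
  have eκ0 : (0 : ℝ) ≤ κ := by exact_mod_cast hκ0
  have eκ1 : (1 : ℝ) ≤ (κ : ℝ) ^ 2 * (2 * ((BSMX.piLo : ℚ) : ℝ) * c) := by
    have := (Rat.cast_le (K := ℝ)).2 hκ1; push_cast at this ⊢; exact this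
  refine ⟨⟨hlaw, hm, ectr, eθ0, emθ, ec0, ec1, em0, em1⟩, eκ0, eκ1.trans ?_⟩
  have hp := BSMX.piLo_le_pi
  have : 0 ≤ (κ : ℝ) ^ 2 * (2 * c) := by positivity
  nlinarith [mul_le_mul_of_nonneg_left hp this]

/-- **The Fourier two-axes tail from a kernel check** (square form): with `ρ = 1/(1+m₀)`,
`X = (2N+2)/(8 piLo c N) + (κ+1) ρ^{2M}/(1-ρ²)` (`M ≤ N`), the check `X² ≤ (Tn/DG)² (3N+1)` gives the tail bound
`Tn/DG` at horizon `N ≥ 1` (using `u 2 N ² ≤ 1/(3N+1)`). -/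
theorem tailBoundH_of_twoFourierQ (ht : 2 ≤ t) {A : List ℕ} {DA : ℕ} (hA : LawNatOK m A DA) {θ₀ c m₀ κ : ℚ}
    (hq : FourierCheckQ m A DA θ₀ c m₀ κ) {M N : ℕ} (hMN : M ≤ N) (hN : 1 ≤ N) {Tn DG : ℕ}
    (h : ((2 * (N : ℚ) + 2) / (8 * BSMX.piLo * c * N) + (κ + 1) * (1 / (1 + m₀)) ^ (2 * M) / (1 - (1 / (1 + m₀)) ^ 2)) ^ 2 ≤
      ((Tn : ℚ) / DG) ^ 2 * (3 * (N : ℚ) + 1)) :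
    TailBoundH t 2 m (lawN m A DA) N ((Tn : ℝ) / DG) := by
  obtain ⟨hF, hκ0, hκ1⟩ := fdata_of_checkQ hA hq
  set Xρ : ℝ := (2 * (N : ℝ) + 2) / (8 * ((BSMX.piLo : ℚ) : ℝ) * c * N) +
    ((κ : ℝ) + 1) * (1 / (1 + (m₀ : ℝ))) ^ (2 * M) / (1 - (1 / (1 + (m₀ : ℝ))) ^ 2) with hXρ
  have h' := (Rat.cast_le (K := ℝ)).2 h
  push_cast at h'
  have hX' : Xρ ^ 2 ≤ ((Tn : ℝ) / DG) ^ 2 * (3 * (N : ℝ) + 1) := by rw [hXρ]; exact h'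
  have hmR : (0 : ℝ) < m₀ := hF.m₀_pos
  have hp0 : (0 : ℝ) < ((BSMX.piLo : ℚ) : ℝ) := by unfold BSMX.piLo; push_cast; norm_num
  have hρ1 : (1 : ℝ) / (1 + m₀) < 1 := by rw [div_lt_one (by linarith)]; linarith
  have hX0 : 0 ≤ Xρ := by
    have hcR : (0 : ℝ) < c := hF.c_pos
    have hNR : (0 : ℝ) < N := by exact_mod_cast hN
    have : 0 < 1 - ((1 : ℝ) / (1 + m₀)) ^ 2 := by nlinarith [(by positivity : (0 : ℝ) ≤ 1 / (1 + m₀))]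
    positivity
  refine tailBound_two_fourier hF hκ0 hκ1 ht hN ?_
  have huN := u_nonneg (d := 2) N
  have hT0 : 0 ≤ (Tn : ℝ) / DG := by positivity
  have hle := BSMX.twoX_le hF.c_pos hmR hκ0 hMN hN
  have h1 : (u 2 N * Xρ) ^ 2 ≤ ((Tn : ℝ) / DG) ^ 2 := by
    rw [mul_pow]
    calc u 2 N ^ 2 * Xρ ^ 2 ≤ 1 / (3 * (N : ℝ) + 1) * (((Tn : ℝ) / DG) ^ 2 * (3 * (N : ℝ) + 1)) :=
          mul_le_mul (BSMX.u_two_sq_le N) hX' (by positivity) (by positivity)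
      _ = ((Tn : ℝ) / DG) ^ 2 := by field_simp
  have h2 : u 2 N * Xρ ≤ (Tn : ℝ) / DG := (pow_le_pow_iff_left₀ (mul_nonneg huN hX0) hT0 two_ne_zero).1 h1
  exact (mul_le_mul_of_nonneg_left (hle.trans (le_of_eq (by rw [hXρ]))) huN).trans h2

/-- **The Fourier `k ≥ 3` tail from a kernel check**: with `ρ = 1/(1+m₀)`,
`k · BQ k q₀ · (q₀+1) · [1/(8 piLo c N) + (κ+1) ρ^{2M}/((N+1)(1-ρ²))] ≤ Tn/DG` (`M ≤ N`, `N ≥ q₀ k`, `N ≥ 1`). -/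
theorem tailBoundH_of_threeFourierQ (hk : 3 ≤ k) (ht : 2 ≤ t) {A : List ℕ} {DA : ℕ} (hA : LawNatOK m A DA)
    {θ₀ c m₀ κ : ℚ} (hq : FourierCheckQ m A DA θ₀ c m₀ κ) {q₀ M N : ℕ} (hN : q₀ * k ≤ N) (hN1 : 1 ≤ N)
    (hMN : M ≤ N) {Tn DG : ℕ}
    (h : (k : ℚ) * BSMX.BQ k q₀ * ((q₀ : ℚ) + 1) *
        (1 / (8 * BSMX.piLo * c * N) + (κ + 1) * (1 / (1 + m₀)) ^ (2 * M) / (((N : ℚ) + 1) * (1 - (1 / (1 + m₀)) ^ 2))) ≤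
      (Tn : ℚ) / DG) :
    TailBoundH t k m (lawN m A DA) N ((Tn : ℝ) / DG) := by
  obtain ⟨hF, hκ0, hκ1⟩ := fdata_of_checkQ hA hq
  have hk0 : 0 < k := by omega
  have h' := (Rat.cast_le (K := ℝ)).2 h
  push_cast at h'
  rw [BSMX.BQ_cast] at h'
  have hmR : (0 : ℝ) < m₀ := hF.m₀_pos
  have hcR : (0 : ℝ) < c := hF.c_pos
  have hNR : (0 : ℝ) < N := by exact_mod_cast hN1
  have hp := BSMX.piLo_le_pi
  have hp0 : (0 : ℝ) < ((BSMX.piLo : ℚ) : ℝ) := by unfold BSMX.piLo; push_cast; norm_num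
  have hρ1 : (1 : ℝ) / (1 + m₀) < 1 := by rw [div_lt_one (by linarith)]; linarith
  refine tailBound_three_fourier hF hκ0 hκ1 hk ht hN hN1 (le_trans ?_ h')
  have hC : 0 ≤ BSMX.Cu k q₀ := BSMX.Cu_nonneg hk0 q₀
  unfold BSMX.Cu
  rw [show (k : ℝ) * B k q₀ * ((q₀ : ℝ) + 1) = BSMX.Cu k q₀ from rfl]
  refine mul_le_mul_of_nonneg_left (add_le_add ?_ ?_) hC
  · exact div_le_div_of_nonneg_left (by positivity) (by positivity) (by gcongr)
  · have hr : Real.exp (-(m₀ : ℝ)) ≤ 1 / (1 + m₀) := by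
      rw [Real.exp_neg, inv_eq_one_div]
      exact one_div_le_one_div_of_le (by linarith) (by linarith [Real.add_one_le_exp (m₀ : ℝ)])
    have hg := BSMX.geo_factor_le (Real.exp_pos (-(m₀ : ℝ))).le hr hρ1 hMN
    rw [mul_div_assoc, mul_div_assoc]
    refine mul_le_mul_of_nonneg_left ?_ (by positivity)
    have := div_le_div_of_nonneg_right hg (by positivity : (0 : ℝ) ≤ (N : ℝ) + 1)
    rw [div_div, div_div, mul_comm (1 - Real.exp (-(m₀ : ℝ)) ^ 2), mul_comm (1 - ((1 : ℝ) / (1 + m₀)) ^ 2)] at this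
    exact this

/-! ### Symmetry of the Green sums: sorted absolute values -/

/-- **Products of the even function `H n` of the coordinates are invariant under canonicalisation.** -/
theorem prod_H_canonK {g : Fin (2 * m + 1) → ℝ} (hg : LawOK m g) (n : ℕ) (δ : Fin t → ℤ) :
    ∏ l, H m g n (canonK δ l) = ∏ l, H m g n (δ l) := by
  rw [← List.prod_ofFn, ← List.prod_ofFn]
  have h1 : List.ofFn (fun l => H m g n (canonK δ l)) = (List.ofFn (canonK δ)).map (H m g n) := by
    rw [List.map_ofFn]; rfl
  have h2 : List.ofFn (fun l => H m g n (δ l)) = (List.ofFn fun l => |δ l|).map (H m g n) := by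
    rw [List.map_ofFn]; exact congr_arg _ (funext fun l => (H_abs hg n (δ l)).symm)
  rw [h1, h2, ofFn_canonK]
  exact ((perm_absSort δ).map _).prod_eq

/-- `G0H` is invariant under canonicalisation. -/
theorem G0H_canonK (k : ℕ) {g : Fin (2 * m + 1) → ℝ} (hg : LawOK m g) (N : ℕ) (δ : Fin t → ℤ) :
    G0H k m g N (canonK δ) = G0H k m g N δ := by
  unfold G0H; exact sum_congr rfl fun i _ => by rw [prod_H_canonK hg]

/-- `G1H` is invariant under canonicalisation. -/
theorem G1H_canonK (k : ℕ) {g : Fin (2 * m + 1) → ℝ} (hg : LawOK m g) (N : ℕ) (δ : Fin t → ℤ) :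
    G1H k m g N (canonK δ) = G1H k m g N δ := by
  unfold G1H; exact sum_congr rfl fun i _ => by rw [prod_H_canonK hg]

end Summit.CriticalPhenomena.PercolationContinuityZ3.Theorems.Pcint.BSMR

end
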